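import Literature.NumberTheory.Transcendental.KZCalculus
import Literature.NumberTheory.Transcendental.SemialgebraicMaps
import HarnessLib
import HarnessLib.Audit

/-!
# FibrewiseStokesGenerationConjecture — CONJECTURE (obligation of KontsevichZagierPeriods/KontsevichZagierPeriods)

The residual of the line `fibrewise_stokes` of the crux `StokesGeneration`
(`Cruxes/StokesGeneration/Lines/fibrewise_stokes.lean`, stub `stub_fibrewiseStokesGeneration`, verbatim):
**fibrewise Stokes generation** — every bounded closed-cube representation `[[0,1]^M, h]` of the
Kontsevich–Zagier calculus (`Literature/NumberTheory/Transcendental/KZCalculus.lean`) whose VALUE is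
`0` is, after padding by dummy variables and off a Lebesgue-null `ℚ`-semialgebraic set, a finite sum
of FIBREWISE STOKES ELEMENTS `D − (G|_{xᵢ=1} − G|_{xᵢ=0})` with `G` bounded, `ℚ`-semialgebraic on the
cube, CONTINUOUS along each closed coordinate-`i` fibre and differentiable along it with derivative
`D` at the interior points off a `ℚ`-semialgebraic set `K` with finite `i`-fibres (kinks allowed).

Provenance: this is Ayoub's compact form of the period conjecture (Ann. of Math. 181 (2015),
Conj. 1.1 = Fresán 2024, Conj. 3.5: type-(a) generation `∂G/∂zᵢ − G|_{zᵢ=1} + G|_{zᵢ=0}` of the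
kernel of `∫_{[0,1]^∞}` on the algebra `𝒪_{ℚ̄-alg}(𝔻̄^∞)` of algebraic power series on the CLOSED
polydisc) TRANSPOSED by the crux strategist / line lead to the regularity class of the
Kontsevich–Zagier calculus itself (bounded semialgebraic integrands; Newton–Leibniz primitives
continuous on closed fibres, differentiable off finitely many fibre points). OUR VARIANT — not in
print in this form; recorded as an open obligation (CONVENTIONS §4), never asserted. It is of summit
strength: together with the two LANDED theorems of the line — `stub_cubifyKernel` (every formal
combination is ≡ one bounded cube representation, `Theorems/UnfoldedStokesStokesGenerationStubCubifyKernel.lean`)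
and `stub_fibrewiseStokesCalibration` (every fibrewise Stokes element is a relation,
`Theorems/UnfoldedStokesStokesGenerationStubFibrewiseStokesCalibration.lean`) — it implies
`KZKernelConjecture`, hence the summit (`Theorems/UnfoldedStokesStokesGenerationFibrewiseBridge.lean`);
the GPC-strength barriers `Literature.Barriers.KontsevichZagierPeriods.kzConjecture_implies_*` apply.
Routes use it as a crux item or via `--conditional-bridge --conditional-on FibrewiseStokesGenerationConjecture`;
a proof would go in `Theorems/FibrewiseStokesGenerationConjectureHolds.lean`.
-/

-- `Summit.KontsevichZagierPeriods.KontsevichZagierPeriods.…` is the tree's mandated layout (single-conjunct summit).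
set_option linter.dupNamespace false

namespace Summit.KontsevichZagierPeriods.KontsevichZagierPeriods

open MeasureTheory
open Literature.NumberTheory.Transcendental
open Literature.NumberTheory.Transcendental.KZ
open Literature.ModelTheory.ExponentialFields (IsSemialgebraic)

/-- OPEN CONJECTURE — **fibrewise Stokes generation** (the residual of line `fibrewise_stokes` of
crux `StokesGeneration`; Ayoub 2015 Conj. 1.1 / Fresán 2024 Conj. 3.5 transposed to the regularity
class of the KZ calculus — our variant, see the module docstring): a bounded closed-cube
representation of value `0` is, after padding by dummy variables, off a null `ℚ`-semialgebraic set,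
a finite sum of fibrewise Stokes elements `D − (G|_{xᵢ=1} − G|_{xᵢ=0})`, `G` bounded
`ℚ`-semialgebraic, continuous along closed `xᵢ`-fibres, differentiable with derivative `D` off a
fibrewise-finite `ℚ`-semialgebraic `K`. Posed here, not proved; summit-strength.
[cite: Ayoub2015, Conj. 1.1 (transposed; our variant)] [status: open] -/
@[conjecture] def FibrewiseStokesGenerationConjecture : Prop :=

    ∀ (M : ℕ) (t : IntegralRep M), t.domain = Set.pi Set.univ (fun _ : Fin M => Set.Icc (0:ℝ) 1) →
      (∃ B : ℝ, ∀ z ∈ t.domain, |t.integrand z| ≤ B) → t.value = 0 →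
      ∃ (M' : ℕ) (hMM' : M ≤ M') (J : ℕ) (i : Fin J → Fin M') (G D : Fin J → (Fin M' → ℝ) → ℝ)
        (K : Fin J → Set (Fin M' → ℝ)) (q : Fin J → IntegralRep M') (Z : Set (Fin M' → ℝ)),
        (∀ j, IsSemialgebraicFunOn ℚ (Set.pi Set.univ (fun _ : Fin M' => Set.Icc (0:ℝ) 1)) (G j) ∧
          IsSemialgebraicFunOn ℚ (Set.pi Set.univ (fun _ : Fin M' => Set.Icc (0:ℝ) 1)) (D j) ∧
          IsSemialgebraic ℚ (K j) ∧
          (∃ B : ℝ, ∀ x ∈ Set.pi Set.univ (fun _ : Fin M' => Set.Icc (0:ℝ) 1), |(G j) x| ≤ B) ∧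
          (∀ x ∈ Set.pi Set.univ (fun _ : Fin M' => Set.Icc (0:ℝ) 1), Set.Finite {s : ℝ | Function.update x (i j) s ∈ (K j)}) ∧
          (∀ x ∈ Set.pi Set.univ (fun _ : Fin M' => Set.Icc (0:ℝ) 1), ContinuousOn (fun s : ℝ => (G j) (Function.update x (i j) s)) (Set.Icc (0:ℝ) 1)) ∧
          (∀ x ∈ Set.pi Set.univ (fun _ : Fin M' => Set.Icc (0:ℝ) 1), x ∉ (K j) → x (i j) ∈ Set.Ioo (0:ℝ) 1 →
            HasDerivAt (fun s : ℝ => (G j) (Function.update x (i j) s)) ((D j) x) (x (i j)))) ∧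
        (∀ j, (q j).domain = Set.pi Set.univ (fun _ : Fin M' => Set.Icc (0:ℝ) 1) ∧
          ∀ x ∈ Set.pi Set.univ (fun _ : Fin M' => Set.Icc (0:ℝ) 1), (q j).integrand x =
            D j x - (G j (Function.update x (i j) 1) - G j (Function.update x (i j) 0))) ∧
        IsSemialgebraic ℚ Z ∧ volume Z = 0 ∧
        ∀ x ∈ Set.pi Set.univ (fun _ : Fin M' => Set.Icc (0:ℝ) 1), x ∉ Z →
          t.integrand (fun l => x (Fin.castLE hMM' l)) = ∑ j, (q j).integrand x

/-- The registered stub `stub_fibrewiseStokesGeneration` of crux stmt-KontsevichZagierPeriods-3586 (line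
`fibrewise_stokes`) is this conjecture, verbatim (definitional unfolding). [cite: Ayoub2015, Conj. 1.1 (transposed; our variant)] -/
theorem fibrewiseStokesGenerationConjecture_iff_stub : FibrewiseStokesGenerationConjecture ↔ (∀ (M : ℕ) (t : IntegralRep M), t.domain = Set.pi Set.univ (fun _ : Fin M => Set.Icc (0:ℝ) 1) → (∃ B : ℝ, ∀ z ∈ t.domain, |t.integrand z| ≤ B) → t.value = 0 → ∃ (M' : ℕ) (hMM' : M ≤ M') (J : ℕ) (i : Fin J → Fin M') (G D : Fin J → (Fin M' → ℝ) → ℝ) (K : Fin J → Set (Fin M' → ℝ)) (q : Fin J → IntegralRep M') (Z : Set (Fin M' → ℝ)), (∀ j, IsSemialgebraicFunOn ℚ (Set.pi Set.univ (fun _ : Fin M' => Set.Icc (0:ℝ) 1)) (G j) ∧ IsSemialgebraicFunOn ℚ (Set.pi Set.univ (fun _ : Fin M' => Set.Icc (0:ℝ) 1)) (D j) ∧ IsSemialgebraic ℚ (K j) ∧ (∃ B : ℝ, ∀ x ∈ Set.pi Set.univ (fun _ : Fin M' => Set.Icc (0:ℝ) 1), |(G j) x| ≤ B) ∧ (∀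 x ∈ Set.pi Set.univ (fun _ : Fin M' => Set.Icc (0:ℝ) 1), Set.Finite {s : ℝ | Function.update x (i j) s ∈ (K j)}) ∧ (∀ x ∈ Set.pi Set.univ (fun _ : Fin M' => Set.Icc (0:ℝ) 1), ContinuousOn (fun s : ℝ => (G j) (Function.update x (i j) s)) (Set.Icc (0:ℝ) 1)) ∧ (∀ x ∈ Set.pi Set.univ (fun _ : Fin M' => Set.Icc (0:ℝ) 1), x ∉ (K j) → x (i j) ∈ Set.Ioo (0:ℝ) 1 → HasDerivAt (fun s : ℝ => (G j) (Function.update x (i j) s)) ((D j) x) (x (i j)))) ∧ (∀ j, (q j).domain = Set.pi Set.univ (fun _ : Fin M' => Set.Icc (0:ℝ) 1) ∧ ∀ x ∈ Set.pi Set.univ (fun _ : Fin M' => Set.Icc (0:ℝ) 1), (q j).integrand x = D j x - (G j (Function.update x (i j) 1) - G j (Function.update x (i j) 0))) ∧ IsSemialgebraic ℚ Z ∧ volume Z = 0 ∧ ∀ x ∈ Set.pi Set.univ (fun _ : Fin M' => Set.Icc (0:ℝ) 1), x ∉ Z → t.integrand (fun l => x (Fin.castLE hMM' l)) = ∑ j,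 (q j).integrand x) :=
  Iff.rfl

end Summit.KontsevichZagierPeriods.KontsevichZagierPeriods
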